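import Mathlib
import HarnessLib
import Summits.SmoothPoincare4.SmoothPoincare4.Theses.ExoticMirrors

/-!
# Birth skeleton (BC3) — crux `ExoticMirrors.ReflectionSoulRigidity` (stmt-SmoothPoincare4-5632)

Route `route-SmoothPoincare4-ExoticMirrors`, crux #2 (ENGINE) `ReflectionSoulRigidity` — fixed, never restated:
if `τ` is a smooth involution of the standard `S⁵` whose fixed-point set is the image of a smoothly embedded
closed connected 4-manifold `F`, and `S⁵` carries a `τ`-invariant `C^∞` Riemannian metric with `Rm(X,Y,Y,X) ≥ 0`
for every Levi-Civita connection (sec ≥ 0), then `F ≅ S⁴`.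

THE LINE = the route's own proof line for this node (route file, RANKED CRUXES #2 and TWO-LAYER PLAN:
"Fix τ is totally geodesic; S⁵ simply connected ⇒ the action is Coxeter with one mirror; the chamber C = S⁵/τ is
compact, sec ≥ 0, with totally geodesic boundary F; Cheeger–Gromoll soul construction rel ∂C ⇒ S⁵ ≅ S(ν ⊕ ε)
equivariantly, F = S(ν), over a soul S (FangGrove2016 Thm (Open Book), k = 1); a sphere bundle over a
positive-dimensional closed S is never S⁵ (π₁ or H₂/Gysin), so S = pt, ν = ℝ⁵, F = S⁴"), typed WITHOUT manifolds
with boundary, chambers, souls or sphere bundles (all absent from Mathlib — the refuter's prover briefing on the item: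
"state the fact τ-equivariantly on S⁵"): the OUTPUT of the soul theorem is recorded as a DICHOTOMY on the dimension
`k` of the soul, each branch stated over Mathlib only —

* `k = 0` (point soul): the chamber is a smooth 5-disc and the mirror `Fix τ` is a smoothly embedded STANDARD `S⁴`;
* `1 ≤ k ≤ 4`: the Sharafutdinov/bundle retraction `C → Σ` of the chamber onto its soul `Σᵏ`, precomposed with the
  fold `S⁵ → C` (`x ↦ x` on `C`, `x ↦ τ x` on `τ C`; continuous since `τ` fixes `∂C = Fix τ` pointwise), is a
  continuous map `p : S⁵ → Σ` with `p ∘ s = id` for the inclusion `s : Σ → S⁵` — i.e. `S⁵` retracts onto a closed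
  manifold of dimension `1 … 4`, which mod-2 cohomology forbids.

So the skeleton has three stubs:

* `stub_soulDichotomy` (G — THE LOAD-BEARING STUB; Cheeger–Gromoll / Fang–Grove): under the crux hypotheses, EITHER
  there is a `C^∞` embedding `j : S⁴ → S⁵` with `range j = Fix τ`, OR there are `k ∈ [1, 4]`, a closed connected smooth
  `k`-manifold `Σ` and continuous `s : Σ → S⁵`, `p : S⁵ → Σ` with `p ∘ s = id`. Size XL (the soul construction for the
  chamber with totally geodesic boundary, FangGrove2016 Thm 16 / "core example" p. 2, CheegerGromoll1972; the point-soul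
  disc; the retraction; plus two formal preliminaries inside its proof: `τ ≠ id` — a smooth embedding of a 4-manifold
  is not onto `S⁵`, Hausdorff dimension / Sard — and Jordan–Brouwer separation of `S⁵` by the closed hypersurface
  `Fix τ`). [FangGrove2016, arXiv:1403.5019, Thm 16 and p. 2] [CheegerGromoll1972] [Sharafutdinov1977]
* `stub_noRetract` (T — KNOWN algebraic topology): no closed connected manifold of dimension `1 ≤ k ≤ 4` is a retract
  of `S⁵` through continuous maps `s`, `p` with `p ∘ s = id`: `s* ∘ p* = id` on `Hᵏ(Σ; ℤ/2) ≅ ℤ/2` (mod-2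
  fundamental class) factors through `Hᵏ(S⁵; ℤ/2) = 0`. Size L in Lean (mod-2 top cohomology of closed manifolds;
  or, smoothly: mod-2 degree — `s` misses a point of `S⁵`, so `p ∘ s ≃ const` has `deg₂ = 0 ≠ 1 = deg₂ id`).
  [Hatcher2002, Thm 3.26 and §3.3] [MilnorTFDV1965, §4]
* `stub_sameImage` (U — KNOWN differential topology): two `C^∞` embeddings `e : F → S⁵`, `j : S⁴ → S⁵` of compact
  4-manifolds with the same range have diffeomorphic sources, `F ≅ S⁴` (`j⁻¹ ∘ e` is a homeomorphism, smooth both ways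
  because a smooth map into an EMBEDDED submanifold is smooth into the submanifold — slice charts from Mathlib's
  immersion normal form). Size M. [LeeISM2013, Thm 5.8, Cor. 5.30, Prop. 5.31]

* `reflectionSoulRigidity_of_stubSigs : G-sig → T-sig → U-sig → (crux, one-step unfolding)` — THE REAL COMPOSITION,
  sorry-free: G gives the dichotomy; T refutes the retraction branch; U turns the standard mirror `j` and the given
  `e` (same range `Fix τ`) into `F ≅ S⁴`.
* `ReflectionSoulRigidity_of : ReflectionSoulRigidity` — THE SKELETON THEOREM: the crux BY NAME from the three
  declared stubs through the composition (the file's only theorem whose head is the crux, as `ledger skeleton check`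
  requires: the skeleton theorem may take no hypotheses other than registered obligations, so the implication content
  lives in `reflectionSoulRigidity_of_stubSigs` and `_of` discharges it with the stubs).

`sorry` occurs ONLY in the three `stub_*` theorems.

## Why this cut (and not G alone)

G isolates exactly the Riemannian-geometric content (the one unproved named fact of the route, ChamberSoul /
Fang–Grove open book with one mirror) and outputs purely topological data; T is the route's "a sphere bundle over a
positive-dimensional closed soul is never S⁵" in its weakest usable form (only a RETRACTION with a section is used —
no bundle, no Gysin sequence); U is the bookkeeping-free but Mathlib-absent uniqueness of the smooth structure induced
on a fixed image. Neither T nor U mentions `τ` or the metric; G does not mention `F`'s diffeomorphism type.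

## Disproof used

None exists: `ledger crux ls stmt-SmoothPoincare4-5632` — "(no workfiles yet)", no `Disproof.lean`, no dead lines,
no landed `Theorems/ReflectionSoulRigidity/Negative/` lemma (2026-08-17). Honoured instead: the refuter's route-review
note on the item (2026-08-15): hypotheses satisfiable non-trivially (round metric + linear reflection); the statement
excludes exactly the Kervaire mirrors (route support `KervaireMirror`, π₁(F) = SL(2,5)) from carrying invariant
sec ≥ 0 — consistent with this line: for a Kervaire mirror G's first branch fails (F ≇ S⁴ via U) and its second is
impossible by T, so G itself certifies "no invariant sec ≥ 0 metric" there, as the route predicts; `[ConnectedSpace F]`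
(hence `Fix τ ≠ ∅`) is used by G; `curvatureForm` sign convention = Lee's (`Rm(X,Y,Y,X) ≥ 0` is sec ≥ 0, round
sphere positive per `ConstantCurvaturePCO.lean`), unchanged from the crux.

## BC3 probes

For each stub `X ∈ {G, T, U}`: `X → ReflectionSoulRigidity` and `X → SmoothPoincare4` by
`first | exact? | simpa | aesop` (files `bc/probe_*.lean`, importing only the route file) — results in the
registrar's NOTES.md and in `Lines/birth.md`.

## References

* F. Fang, K. Grove, *Reflection groups in non-negative curvature*, J. Differential Geom. 102 (2016), 179–205,
  arXiv:1403.5019 — p. 2 "core example" and Thm 16 (Open Book), k = 1. [FangGrove2016]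
* J. Cheeger, D. Gromoll, *On the structure of complete manifolds of nonnegative curvature*, Ann. of Math. 96 (1972),
  413–443 (soul construction; §1 convex sets with boundary). [CheegerGromoll1972]
* V. A. Sharafutdinov, *The Pogorelov–Klingenberg theorem for manifolds homeomorphic to ℝⁿ*, Sib. Math. J. 18 (1977)
  (distance-nonincreasing retraction onto the soul). [Sharafutdinov1977]
* A. Hatcher, *Algebraic Topology* (2002), Thm 3.26 (mod-2 fundamental class), §3.3. [Hatcher2002]
* J. Milnor, *Topology from the differentiable viewpoint* (1965), §4 (mod-2 degree). [MilnorTFDV1965]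
* J. M. Lee, *Introduction to Smooth Manifolds*, 2nd ed. (2013), Thm 5.8, Cor. 5.30, Prop. 5.31 (embedded
  submanifolds; restricting the codomain; uniqueness of the smooth structure on an embedded image). [LeeISM2013]
-/

-- `Summit.<Summit>.<Problem>`: single-conjunct summit, the duplicate component is mandated (CONVENTIONS §2).
set_option linter.dupNamespace false
set_option linter.unusedVariables false

noncomputable section

namespace Summit.SmoothPoincare4.SmoothPoincare4.Cruxes.ReflectionSoulRigidity.Birth

open scoped Manifold ContDiff Topology
open Set Function
open Summit.SmoothPoincare4.SmoothPoincare4.Theses.ExoticMirrors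

/-! ## The three registered stubs

Vocabulary (all inline, Mathlib + the tree's `Literature.Geometry.Lorentzian.PseudoRiemannianMetric` API exactly as
in the crux): `S⁵ := Metric.sphere (0 : EuclideanSpace ℝ (Fin 6)) 1` (model `𝓡 5`),
`S⁴ := Metric.sphere (0 : EuclideanSpace ℝ (Fin 5)) 1` (model `𝓡 4`); the crux's metric hypothesis is copied
verbatim into stub G. -/

/-- **Stub G `stub_soulDichotomy` — THE SOUL DICHOTOMY OF A NONNEGATIVELY CURVED MIRROR (load-bearing).**
Let `τ` be a smooth involution of `S⁵` whose fixed-point set is the image of a `C^∞` embedding `e` of a closed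
connected 4-manifold `F`, and suppose `S⁵` carries a `τ`-invariant `C^∞` Riemannian metric with `Rm(X,Y,Y,X) ≥ 0`
for every Levi-Civita connection. Then EITHER the mirror is standard — some `C^∞` embedding `j : S⁴ → S⁵` has
`range j = Fix τ` — OR `S⁵` retracts onto a small closed manifold: there are `k ∈ [1, 4]`, a compact connected
Hausdorff smooth `k`-manifold `Σ` and continuous `s : Σ → S⁵`, `p : S⁵ → Σ` with `p ∘ s = id`.
Why true: `τ ≠ id` (a 4-manifold does not embed ONTO `S⁵`), so `dτ` is the reflection in `T(Fix τ)` along the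
mirror, which is a closed totally geodesic hypersurface separating `S⁵` (Jordan–Brouwer; `S⁵` simply connected, the
action is Coxeter with one mirror) into two isometric chambers `C`, `τ C` — compact, sec ≥ 0, totally geodesic
boundary. The Cheeger–Gromoll soul construction rel `∂C` (Fang–Grove, core example p. 2 and Thm 16 with k = 1) makes
`C` the normal disc bundle `D(ν)` of a closed totally geodesic soul `Σᵏ ⊂ int C`, `0 ≤ k ≤ 4`, and
`(S⁵, τ) ≅ (S(ν ⊕ ε), reflection in ε)` equivariantly. If `k = 0`: `C ≅ D⁵`, `Fix τ = ∂C ≅ S⁴` smoothly embedded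
(first branch). If `k ≥ 1`: the bundle (Sharafutdinov) retraction `C → Σ` composed with the fold `S⁵ → C`
(identity on `C`, `τ` on `τ C`, continuous by pasting along `Fix τ`) is `p`, the inclusion of the soul is `s`
(second branch). Size XL. [cite: FangGrove2016, Thm 16 (Open Book, k = 1) and p. 2; CheegerGromoll1972;
Sharafutdinov1977] -/
theorem stub_soulDichotomy :
    ∀ (τ : (Metric.sphere (0 : EuclideanSpace ℝ (Fin 6)) 1) ≃ₘ⟮𝓡 5, 𝓡 5⟯ (Metric.sphere (0 : EuclideanSpace ℝ (Fin 6)) 1)),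
      (∀ x, τ (τ x) = x) →
    ∀ (F : Type) [TopologicalSpace F] [T2Space F] [SecondCountableTopology F] [CompactSpace F] [ConnectedSpace F]
      [ChartedSpace (EuclideanSpace ℝ (Fin 4)) F] [IsManifold (𝓡 4) ∞ F]
      (e : F → Metric.sphere (0 : EuclideanSpace ℝ (Fin 6)) 1),
      Manifold.IsSmoothEmbedding (𝓡 4) (𝓡 5) ∞ e → Set.range e = Function.fixedPoints τ →
      (∃ g : Literature.Geometry.Lorentzian.PseudoRiemannianMetric (𝓡 5) ∞ (EuclideanSpace ℝ (Fin 5))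
          (TangentSpace (𝓡 5) : Metric.sphere (0 : EuclideanSpace ℝ (Fin 6)) 1 → Type _),
        g.IsRiemannian ∧ Literature.Geometry.Lorentzian.PseudoRiemannianMetric.IsIsometry g g τ ∧
        ∀ cov, g.IsLeviCivita cov → ∀ x (X Y : TangentSpace (𝓡 5) x), 0 ≤ g.curvatureForm cov x X Y Y X) →
      (∃ j : Metric.sphere (0 : EuclideanSpace ℝ (Fin 5)) 1 → Metric.sphere (0 : EuclideanSpace ℝ (Fin 6)) 1,
          Manifold.IsSmoothEmbedding (𝓡 4) (𝓡 5) ∞ j ∧ Set.range j = Function.fixedPoints τ) ∨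
      (∃ k : ℕ, 1 ≤ k ∧ k ≤ 4 ∧
        ∃ (S : Type) (_ : TopologicalSpace S) (_ : T2Space S) (_ : CompactSpace S) (_ : ConnectedSpace S)
          (_ : ChartedSpace (EuclideanSpace ℝ (Fin k)) S) (_ : IsManifold (𝓡 k) ∞ S)
          (s : S → Metric.sphere (0 : EuclideanSpace ℝ (Fin 6)) 1)
          (p : Metric.sphere (0 : EuclideanSpace ℝ (Fin 6)) 1 → S),
          Continuous s ∧ Continuous p ∧ ∀ y, p (s y) = y) := by
  sorry

/-- **Stub T `stub_noRetract` — `S⁵` DOES NOT RETRACT ONTO A CLOSED MANIFOLD OF DIMENSION 1 … 4 (known).**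
For `1 ≤ k ≤ 4` and a compact connected Hausdorff (smooth) `k`-manifold `Σ` there are no continuous
`s : Σ → S⁵`, `p : S⁵ → Σ` with `p (s y) = y` for all `y`. Why true: `Σ` is a closed connected `k`-manifold, so
`Hᵏ(Σ; ℤ/2) ≅ ℤ/2` (mod-2 fundamental class); `s* ∘ p* = (p ∘ s)* = id` on it, yet `p*` lands in
`Hᵏ(S⁵; ℤ/2) = 0` for `0 < k < 5` — contradiction. (Smooth alternative: approximate `s`, `p` smoothly; `s(Σ)` misses
a point of `S⁵` since `k < 5`, so `p ∘ s ≃ const` and `deg₂ (p ∘ s) = 0 ≠ 1 = deg₂ id`.) Size L in Lean (mod-2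
(co)homology top class or mod-2 degree, neither in Mathlib; the tree has singular homology of spheres).
[cite: Hatcher2002, Thm 3.26 and §3.3; MilnorTFDV1965, §4] -/
theorem stub_noRetract :
    ∀ (k : ℕ), 1 ≤ k → k ≤ 4 →
    ∀ (S : Type) [TopologicalSpace S] [T2Space S] [CompactSpace S] [ConnectedSpace S]
      [ChartedSpace (EuclideanSpace ℝ (Fin k)) S] [IsManifold (𝓡 k) ∞ S]
      (s : S → Metric.sphere (0 : EuclideanSpace ℝ (Fin 6)) 1)
      (p : Metric.sphere (0 : EuclideanSpace ℝ (Fin 6)) 1 → S),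
      Continuous s → Continuous p → (∀ y, p (s y) = y) → False := by
  sorry

/-- **Stub U `stub_sameImage` — TWO EMBEDDINGS WITH THE SAME IMAGE HAVE DIFFEOMORPHIC SOURCES (known).**
If `e : F → S⁵` (from a compact Hausdorff second-countable `C^∞` 4-manifold `F`) and `j : S⁴ → S⁵` are `C^∞`
embeddings (Mathlib `Manifold.IsSmoothEmbedding`: immersion + topological embedding) with `range e = range j`, then
`F ≅ S⁴` (`C^∞` diffeomorphism for the given atlas of `F`). Why true: `j⁻¹ ∘ e : F → S⁴` is a homeomorphism
(both maps are embeddings onto the common image `A`); near each point `A` is a slice of a chart of `S⁵` (immersion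
normal form of `j`, Mathlib `IsImmersionAt`), and a `C^∞` map with values in an embedded submanifold is `C^∞` into
it, so `j⁻¹ ∘ e` and its inverse `e⁻¹ ∘ j` are `C^∞`. Size M (Lee's Cor. 5.30 is not in Mathlib).
[cite: LeeISM2013, Thm 5.8, Cor. 5.30, Prop. 5.31] -/
theorem stub_sameImage :
    ∀ (F : Type) [TopologicalSpace F] [T2Space F] [SecondCountableTopology F] [CompactSpace F]
      [ChartedSpace (EuclideanSpace ℝ (Fin 4)) F] [IsManifold (𝓡 4) ∞ F]
      (e : F → Metric.sphere (0 : EuclideanSpace ℝ (Fin 6)) 1)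
      (j : Metric.sphere (0 : EuclideanSpace ℝ (Fin 5)) 1 → Metric.sphere (0 : EuclideanSpace ℝ (Fin 6)) 1),
      Manifold.IsSmoothEmbedding (𝓡 4) (𝓡 5) ∞ e → Manifold.IsSmoothEmbedding (𝓡 4) (𝓡 5) ∞ j →
      Set.range e = Set.range j →
      Nonempty (F ≃ₘ⟮𝓡 4, 𝓡 4⟯ Metric.sphere (0 : EuclideanSpace ℝ (Fin 5)) 1) := by
  sorry

/-! ## The composition (kernel-checked; no `sorry` of its own) -/

/-- Local notation (composition only; the stubs above are spelled out): the standard 5-sphere. -/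
local notation "𝕊⁵" => (Metric.sphere (0 : EuclideanSpace ℝ (Fin 6)) 1)
/-- Local notation (composition only): the standard 4-sphere. -/
local notation "𝕊⁴" => (Metric.sphere (0 : EuclideanSpace ℝ (Fin 5)) 1)

/-- **Composition with explicit hypotheses** (`G-sig → T-sig → U-sig → ReflectionSoulRigidity`, the conclusion
written as the crux's one-step unfolding so that `ReflectionSoulRigidity_of` below is the file's only theorem whose
head is the crux name). Proof: pure logic — the soul dichotomy (G) at the given mirror; its retraction branch is
absurd by (T); its standard-mirror branch hands `e` and `j` (same range `Fix τ`) to (U). [folklore] -/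
theorem reflectionSoulRigidity_of_stubSigs
    (hG : ∀ (τ : 𝕊⁵ ≃ₘ⟮𝓡 5, 𝓡 5⟯ 𝕊⁵), (∀ x, τ (τ x) = x) →
      ∀ (F : Type) [TopologicalSpace F] [T2Space F] [SecondCountableTopology F] [CompactSpace F] [ConnectedSpace F]
        [ChartedSpace (EuclideanSpace ℝ (Fin 4)) F] [IsManifold (𝓡 4) ∞ F] (e : F → 𝕊⁵),
        Manifold.IsSmoothEmbedding (𝓡 4) (𝓡 5) ∞ e → Set.range e = Function.fixedPoints τ →
        (∃ g : Literature.Geometry.Lorentzian.PseudoRiemannianMetric (𝓡 5) ∞ (EuclideanSpace ℝ (Fin 5))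
            (TangentSpace (𝓡 5) : 𝕊⁵ → Type _),
          g.IsRiemannian ∧ Literature.Geometry.Lorentzian.PseudoRiemannianMetric.IsIsometry g g τ ∧
          ∀ cov, g.IsLeviCivita cov → ∀ x (X Y : TangentSpace (𝓡 5) x), 0 ≤ g.curvatureForm cov x X Y Y X) →
        (∃ j : 𝕊⁴ → 𝕊⁵, Manifold.IsSmoothEmbedding (𝓡 4) (𝓡 5) ∞ j ∧ Set.range j = Function.fixedPoints τ) ∨
        (∃ k : ℕ, 1 ≤ k ∧ k ≤ 4 ∧
          ∃ (S : Type) (_ : TopologicalSpace S) (_ : T2Space S) (_ : CompactSpace S) (_ : ConnectedSpace S)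
            (_ : ChartedSpace (EuclideanSpace ℝ (Fin k)) S) (_ : IsManifold (𝓡 k) ∞ S)
            (s : S → 𝕊⁵) (p : 𝕊⁵ → S), Continuous s ∧ Continuous p ∧ ∀ y, p (s y) = y))
    (hT : ∀ (k : ℕ), 1 ≤ k → k ≤ 4 →
      ∀ (S : Type) [TopologicalSpace S] [T2Space S] [CompactSpace S] [ConnectedSpace S]
        [ChartedSpace (EuclideanSpace ℝ (Fin k)) S] [IsManifold (𝓡 k) ∞ S] (s : S → 𝕊⁵) (p : 𝕊⁵ → S),
        Continuous s → Continuous p → (∀ y, p (s y) = y) → False)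
    (hU : ∀ (F : Type) [TopologicalSpace F] [T2Space F] [SecondCountableTopology F] [CompactSpace F]
        [ChartedSpace (EuclideanSpace ℝ (Fin 4)) F] [IsManifold (𝓡 4) ∞ F] (e : F → 𝕊⁵) (j : 𝕊⁴ → 𝕊⁵),
        Manifold.IsSmoothEmbedding (𝓡 4) (𝓡 5) ∞ e → Manifold.IsSmoothEmbedding (𝓡 4) (𝓡 5) ∞ j →
        Set.range e = Set.range j → Nonempty (F ≃ₘ⟮𝓡 4, 𝓡 4⟯ 𝕊⁴)) :
    ∀ (τ : 𝕊⁵ ≃ₘ⟮𝓡 5, 𝓡 5⟯ 𝕊⁵), (∀ x, τ (τ x) = x) →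
      ∀ (F : Type) [TopologicalSpace F] [T2Space F] [SecondCountableTopology F] [CompactSpace F] [ConnectedSpace F]
        [ChartedSpace (EuclideanSpace ℝ (Fin 4)) F] [IsManifold (𝓡 4) ∞ F] (e : F → 𝕊⁵),
        Manifold.IsSmoothEmbedding (𝓡 4) (𝓡 5) ∞ e → Set.range e = Function.fixedPoints τ →
        (∃ g : Literature.Geometry.Lorentzian.PseudoRiemannianMetric (𝓡 5) ∞ (EuclideanSpace ℝ (Fin 5))
            (TangentSpace (𝓡 5) : 𝕊⁵ → Type _),
          g.IsRiemannian ∧ Literature.Geometry.Lorentzian.PseudoRiemannianMetric.IsIsometry g g τ ∧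
          ∀ cov, g.IsLeviCivita cov → ∀ x (X Y : TangentSpace (𝓡 5) x), 0 ≤ g.curvatureForm cov x X Y Y X) →
        Nonempty (F ≃ₘ⟮𝓡 4, 𝓡 4⟯ 𝕊⁴) := by
  intro τ hτ F _ _ _ _ _ _ _ e he hfix hg
  rcases hG τ hτ F e he hfix hg with ⟨j, hj, hjfix⟩ | ⟨k, hk1, hk4, S, _, _, _, _, _, _, s, p, hs, hp, hps⟩
  · exact hU F e j he hj (hfix.trans hjfix.symm)
  · exact (hT k hk1 hk4 S s p hs hp hps).elim

/-- **THE SKELETON THEOREM.** The crux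
`Summit.SmoothPoincare4.SmoothPoincare4.Theses.ExoticMirrors.ReflectionSoulRigidity`, concluded BY NAME from the three
DECLARED stubs `stub_soulDichotomy`, `stub_noRetract`, `stub_sameImage` (the only `sorry`s of the file) through the
sorry-free composition `reflectionSoulRigidity_of_stubSigs`. [folklore] -/
theorem ReflectionSoulRigidity_of :
    Summit.SmoothPoincare4.SmoothPoincare4.Theses.ExoticMirrors.ReflectionSoulRigidity :=
  reflectionSoulRigidity_of_stubSigs stub_soulDichotomy stub_noRetract stub_sameImage

end Summit.SmoothPoincare4.SmoothPoincare4.Cruxes.ReflectionSoulRigidity.Birth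

end
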